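import Mathlib.Tactic
import Literature.Computability.QuantumComplexity.BQPSubsetPP
import Literature.Computability.QuantumComplexity.PromiseBQPSubsetPromisePP
import Literature.Computability.QuantumComplexity.SimUniformity
import Literature.Computability.Complexity.Promise
import Literature.Computability.Cryptography.ClassBQP
import Summits.QuantumAdvantage.QuantumAdvantage.Statement
import HarnessLib

/-!
# SoloInformedPromiseLiftPP — the lift hypothesis `Q-EXT` is not summit-strength

Solo seat `solo-QuantumAdvantage-informed` (ideation tier, summit-directed); new mathematics for the summit
`QuantumAdvantage := ∃ L, L ∈ BQP ∧ L ∉ BPP`, continuing `SoloInformedPseudoDeterministicLift` (whose assembly is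
`Q-EXT ∧ ¬(PromiseBQP ⊆ promiseLift BPP) → QuantumAdvantage`, `Q-EXT := PromiseBQP ⊆ promiseLift BQP`).

From the tree's `PromiseBQP_subset_promiseLift_PP` (every `PromiseBQP` problem is SOLVED by a `PP` language —
Adleman–DeMarrais–Huang counting read off the promise):
* `promiseIsLift_of_PP_subset_BQP : PP ⊆ BQP → Q-EXT`;
* `promiseIsLift_and_not_quantumAdvantage_of_PP_subset_BPP : PP ⊆ BPP → Q-EXT ∧ ¬ QuantumAdvantage` — in every
  collapse world `PP = BPP` the lift hypothesis HOLDS while the summit FAILS. So `Q-EXT` alone is not summit-strength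
  (it is consistent with `¬ QuantumAdvantage` relative to everything provable about these classes), and the assembly
  `quantumAdvantage_of_promiseIsLift` genuinely needs its promise-separation hypothesis; dually, the promise
  separation `¬(PromiseBQP ⊆ promiseLift BPP)` alone already gives `PP ⊄ BPP`
  (`not_PP_subset_BPP_of_promiseSep`).

[cite: AdlemanDeMarraisHuang1997, Thm. 6.4 and Lemma 6.10] [cite: Goldreich2006, Def. 1.2]
-/

noncomputable section

namespace Summit.QuantumAdvantage.QuantumAdvantage.Theorems

open _root_.Computability Literature.Computability.Complexity Literature.Computability.Cryptography
  Literature.Computability.QuantumComplexity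

/-- If `PP ⊆ BQP` then every `PromiseBQP` problem is solved by a `BQP` language (`Q-EXT`), by
`PromiseBQP ⊆ promiseLift PP` and monotonicity of `promiseLift`. [cite: AdlemanDeMarraisHuang1997, Thm. 6.4] -/
theorem promiseIsLift_of_PP_subset_BQP (h : PP ⊆ BQP) : PromiseBQP ⊆ promiseLift BQP :=
  PromiseBQP_subset_promiseLift_PP.trans (promiseLift_mono h)

/-- **`Q-EXT` is not summit-strength.** In any collapse world `PP ⊆ BPP` the lift hypothesis
`Q-EXT : PromiseBQP ⊆ promiseLift BQP` HOLDS (via `PP ⊆ BPP ⊆ BQP`, the tree's discharged fact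
`BPP_subset_BQP_holds`) while the summit FAILS (`BQP ⊆ PP ⊆ BPP`, `BQP_subset_PP_holds`).
[cite: AdlemanDeMarraisHuang1997, Thm. 6.4] -/
theorem promiseIsLift_and_not_quantumAdvantage_of_PP_subset_BPP (h : PP ⊆ BPP) :
    PromiseBQP ⊆ promiseLift BQP ∧ ¬ QuantumAdvantage := by
  refine ⟨promiseIsLift_of_PP_subset_BQP (h.trans fun L hL => BPP_subset_BQP_holds hL), ?_⟩
  rintro ⟨L, hL, hLB⟩
  exact hLB (h (BQP_subset_PP_holds hL))

/-- Dually, the promise-separation hypothesis of the assembly, `¬(PromiseBQP ⊆ promiseLift BPP)` ("some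
`PromiseBQP` problem is solved by no `BPP` language"), alone gives `PP ⊄ BPP` — the promise-level floor.
[cite: AdlemanDeMarraisHuang1997, Thm. 6.4] -/
theorem not_PP_subset_BPP_of_promiseSep (hSep : ¬ PromiseBQP ⊆ PromiseBPP) : ¬ PP ⊆ BPP := fun h =>
  hSep (PromiseBQP_subset_promiseLift_PP.trans (promiseLift_mono h))

end Summit.QuantumAdvantage.QuantumAdvantage.Theorems

end
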